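import Summits.HodgeConjecture.HodgeConjecture.Theorems.K2E1bCubicCasimirVertex
import Summits.HodgeConjecture.HodgeConjecture.Theorems.K2E1bDSClsOfRecord
import HarnessLib

/-!
# K2 ∕ E1b — LAWS BRICK U8-4c (iii) «CALIBRATION»: `HasCubicPin (dsClsOfRecord a b c j) (cubicOf a b c)` for the three record cells

Cell hodgecm-mathlib, Track B «K2-LIT», engine E1b, unit U8 «archimedean packet signs»; crux item h413 = stmt-HodgeConjecture-24833
(supports-only helper; closes nothing by itself).  The EXISTENCE half of row U8-4c of TABLE ED. 8 §2d (K2E1b-plan (g3)), asked of the desk by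
K2E4-p10 (g3) 2026-09-04T03:29Z («your existence half then closes `HasCubicPin (dsClsOfRecord a b c j) (cubicOf a b c)`»; the UNIQUENESS half
`eq_cubicOf_of_hasCubicPin_dsClsOfRecord` is p10's `Theorems/K2E1bDatumCubicScalar.lean`); author K2-defs1 (g3).  GUARD B of K2E1b-r01 (g3∕g4) («before
any socket names `cubicOf`, land the calibration») is hereby DISCHARGED: the record realisation carries `cubicOf a b c` ON THE NOSE — no outer automorphism,
no permuted parameter.  THEOREMS ONLY — no definition, no `sorry`, no axiom, no instance (one `attribute [local instance] LieRing.ofAssociativeRing`), no notation.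

## The proof (one corner or vertex per cell; ★ = in the tree)

`dsClsOfRecord a b c j = GKIrrClass.mk (dsCellRep a b c j h)` (★ `dsClsOfRecord_of_regular`), and the pin may be computed on THAT representative
(★ `hasCubicPin_mk_iff`, U8-4c-A); its action is the central twist `σOfRecord (dsCellDatum j a b c) (centralOf a b c)` of the irreducible cell datum
(★ `σOfRecord_isTwistOf`, ★ `dsCellDatum_isIrreducible`) with `z = (a+b+c)∕3`.  Then:
* `j = 1` (`D_φ⁺`): the Blattner corner `(a−b, a+b−2c+3)` has no `K`-type at `(n ± 1, m − 3)` (★ `dsCellDatum_vertex_one`) — a BOTTOM-extreme corner;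
  ★ `hasCubicScalar_cubicOf_of_isTwistOf_vec_bottom` (U8-4c-B) with Harish-Chandra coordinates `(c, a, b)` (and `cubicOf` is symmetric);
* `j = 2` (`D_φ⁻`): the corner `(b−c, b+c−2a−3)` has no `K`-type at `(n ± 1, m + 3)` (★ `dsCellDatum_vertex_two`) — a TOP-extreme corner;
  ★ `hasCubicScalar_cubicOf_of_isTwistOf_vec_top` with coordinates `(b, c, a)`;
* `j = 0` (`D_φ`): the vertex `(a−c+1, a+c−2b)` is a LOCAL MINIMUM (no `K`-type at `(n−1, m±3)`, ★ `dsCellDatum_vertex_zero`; `n = a−c+1 ≥ 5`);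
  ★ `hasCubicScalar_cubicOf_of_isTwistOf_vertex` (U8-4c-C) with coordinates `(a, b, c)`.
In each case the three coordinate identities are `push_cast; ring`.

Sources: [Rogawski1990] §12.3 pp. 176–178 (the packet `{D_φ, D_φ⁺, D_φ⁻}` at the infinitesimal character `χ_φ`, `φ = (a,b,c)`); [Kovacevic2021] §3 Thm 1–3,
Remark 3; [Iachello2015] §7.4.1 (7.24); [KnappVogan1995] Prop. 4.120.

HONEST LABEL: HC_CM is proved only modulo the 7 printed citations (2 remaining named inputs: hLiu418 = stmt-HodgeConjecture-24832,
h413 = stmt-HodgeConjecture-24833) until rung 0 closes; the calibration is a count-neutral LAWS brick (it lets socket 8b ∕ U8d speak of `cubicOf` by name).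
-/

set_option autoImplicit false
set_option linter.dupNamespace false

noncomputable section

namespace Summit.HodgeConjecture.HodgeConjecture.Cruxes.H413.K2E1bGKCohomologyU21

open Literature.NumberTheory.Automorphic
open Literature.RepresentationTheory
open Literature.RepresentationTheory.Kovacevic2021 Literature.RepresentationTheory.Kovacevic2021.SU21Datum
open Summit.HodgeConjecture.HodgeConjecture.Cruxes.H413.F0P3bLocalAPacketsDefs
open Summit.HodgeConjecture.HodgeConjecture.Cruxes.H413.K2E1bGKCohomologyU21.U8
open Summit.HodgeConjecture.HodgeConjecture.Cruxes.H413.K2E1bCarriersOfRecord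
open Summit.HodgeConjecture.HodgeConjecture.Cruxes.H413.K2E1bDSCellData
open Summit.HodgeConjecture.HodgeConjecture.Cruxes.H413.K2E1bDSClsOfRecord

-- Mathlib idiom (as in `GKModules`, the `Upq*` files, the Kovačević topic): commutator bracket on `Module.End` ∕ matrices
attribute [local instance 100] LieRing.ofAssociativeRing

section Calibration

variable {a b c : ℤ}

/-- **`D_φ⁺` (j = 1) carries the cubic scalar `cubicOf a b c`** on its record representative: bottom-extreme Blattner corner `(a−b, a+b−2c+3)`,
Harish-Chandra coordinates `(c, a, b)`. [cite: Rogawski1990, §12.3 p. 177] [cite: Iachello2015, (7.24)] -/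
theorem hasCubicScalar_dsCellRep_one (h : IsRegularParam a b c) :
    HasCubicScalar (dsCellRep a b c 1 h).ρ𝔤 ((cubicOf a b c : ℤ) : ℂ) := by
  haveI := dsCellDatum_isIrreducible h (1 : Fin 3)
  obtain ⟨hS, hW, hE⟩ := dsCellDatum_vertex_one h
  have key := hasCubicScalar_cubicOf_of_isTwistOf_vec_bottom (dsCellDatum 1 a b c) (σOfRecord_isTwistOf (dsCellDatum 1 a b c) (centralOf a b c))
    hS hE hW c a b (by unfold centralOf; push_cast; ring) (by unfold centralOf; push_cast; ring) (by unfold centralOf; push_cast; ring)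
  have hperm : cubicOf c a b = cubicOf a b c := by unfold cubicOf; ring
  rw [hperm] at key
  exact key

/-- **`D_φ⁻` (j = 2) carries the cubic scalar `cubicOf a b c`**: top-extreme corner `(b−c, b+c−2a−3)`, Harish-Chandra coordinates `(b, c, a)`.
[cite: Rogawski1990, §12.3 p. 177] [cite: Iachello2015, (7.24)] -/
theorem hasCubicScalar_dsCellRep_two (h : IsRegularParam a b c) :
    HasCubicScalar (dsCellRep a b c 2 h).ρ𝔤 ((cubicOf a b c : ℤ) : ℂ) := by
  haveI := dsCellDatum_isIrreducible h (2 : Fin 3)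
  obtain ⟨hS, hW, hE⟩ := dsCellDatum_vertex_two h
  have key := hasCubicScalar_cubicOf_of_isTwistOf_vec_top (dsCellDatum 2 a b c) (σOfRecord_isTwistOf (dsCellDatum 2 a b c) (centralOf a b c))
    hS hE hW b c a (by unfold centralOf; push_cast; ring) (by unfold centralOf; push_cast; ring) (by unfold centralOf; push_cast; ring)
  have hperm : cubicOf b c a = cubicOf a b c := by unfold cubicOf; ring
  rw [hperm] at key
  exact key

/-- **`D_φ` (j = 0) carries the cubic scalar `cubicOf a b c`**: its vertex `(a−c+1, a+c−2b)` is a local minimum of the arrow graph (no Borel-extreme vector),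
and the VERTEX FORM (★ U8-4c-C, relations (b20)∕(b25)) gives the Harish-Chandra coordinates `(a, b, c)` on the nose.
[cite: Rogawski1990, §12.3 p. 177] [cite: Kovacevic2021, §3 Thm 2, Remark 3] [cite: Iachello2015, (7.24)] -/
theorem hasCubicScalar_dsCellRep_zero (h : IsRegularParam a b c) :
    HasCubicScalar (dsCellRep a b c 0 h).ρ𝔤 ((cubicOf a b c : ℤ) : ℂ) := by
  haveI := dsCellDatum_isIrreducible h (0 : Fin 3)
  obtain ⟨hS, hSW, hNW, -⟩ := dsCellDatum_vertex_zero h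
  exact hasCubicScalar_cubicOf_of_isTwistOf_vertex (dsCellDatum 0 a b c) (σOfRecord_isTwistOf (dsCellDatum 0 a b c) (centralOf a b c))
    hS hNW hSW (by obtain ⟨h1, h2⟩ := h; omega) a b c
    (by unfold centralOf; push_cast; ring) (by unfold centralOf; push_cast; ring) (by unfold centralOf; push_cast; ring)

/-- **The record representative of every member carries `cubicOf a b c`.** [cite: Rogawski1990, §12.3 p. 177] [cite: Iachello2015, (7.24)] -/
theorem hasCubicScalar_dsCellRep (h : IsRegularParam a b c) (j : Fin 3) :
    HasCubicScalar (dsCellRep a b c j h).ρ𝔤 ((cubicOf a b c : ℤ) : ℂ) := by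
  fin_cases j
  · exact hasCubicScalar_dsCellRep_zero h
  · exact hasCubicScalar_dsCellRep_one h
  · exact hasCubicScalar_dsCellRep_two h

/-- **CALIBRATION (U8-4c (iii), existence half): every class of record has the cubic pin `cubicOf a b c`** — `HasCubicPin (dsClsOfRecord a b c j) ↑(cubicOf a b c)`
at every regular parameter, for `j = 0, 1, 2` (`D_φ, D_φ⁺, D_φ⁻`); with K2E4-p10's uniqueness `eq_cubicOf_of_hasCubicPin_dsClsOfRecord` the pin is EXACTLY `cubicOf a b c`.
[cite: Rogawski1990, §12.3 pp. 176–178] [cite: Iachello2015, (7.24)] [cite: Molev2007, §7.1] -/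
theorem hasCubicPin_dsClsOfRecord (h : IsRegularParam a b c) (j : Fin 3) :
    HasCubicPin (dsClsOfRecord a b c j) ((cubicOf a b c : ℤ) : ℂ) := by
  rw [dsClsOfRecord_of_regular h j]
  exact hasCubicPin_mk _ (hasCubicScalar_dsCellRep h j)

/-- The calibration as a law of the carrier table ★ `dsCarriersOfRecord`. [cite: Rogawski1990, §12.3 p. 178] -/
theorem hasCubicPin_dsCarriersOfRecord (h : IsRegularParam a b c) (j : Fin 3) :
    HasCubicPin (dsCarriersOfRecord.cls a b c j) ((cubicOf a b c : ℤ) : ℂ) :=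
  hasCubicPin_dsClsOfRecord h j

/-- **The three members of `Π(φ)` have the SAME cubic pin** (as they must: same infinitesimal character `χ_φ`). [cite: Rogawski1990, §12.3 p. 177] -/
theorem sameCubicPin_dsClsOfRecord (h : IsRegularParam a b c) (i j : Fin 3) :
    SameCubicPin (dsClsOfRecord a b c i) (dsClsOfRecord a b c j) :=
  ⟨_, hasCubicPin_dsClsOfRecord h i, hasCubicPin_dsClsOfRecord h j⟩

/-- **RELATIVE = ABSOLUTE for the LEVEL-B′ pin**: at a regular parameter, a class `x` has the cubic pin of the record cell `j` iff it has cubic pin `cubicOf a b c`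
(★ `sameCubicPin_iff_of_hasCubicPin`, U8-4c-A). [cite: Rogawski1990, §12.3 p. 177] [cite: Iachello2015, (7.24)] -/
theorem sameCubicPin_dsClsOfRecord_iff (h : IsRegularParam a b c) (j : Fin 3) (x : GKIrrClass G21) :
    SameCubicPin x (dsClsOfRecord a b c j) ↔ HasCubicPin x ((cubicOf a b c : ℤ) : ℂ) :=
  sameCubicPin_iff_of_hasCubicPin (hasCubicPin_dsClsOfRecord h j)

end Calibration

end Summit.HodgeConjecture.HodgeConjecture.Cruxes.H413.K2E1bGKCohomologyU21

end
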